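import Summits.NavierStokesRegularity.NavierStokesRegularity.Theses.SqueezeCycle
import Summits.NavierStokesRegularity.NavierStokesRegularity.Theorems.RecurrentProfilesRecurrentReduction
import Summits.NavierStokesRegularity.NavierStokesRegularity.Theorems.SqueezeCycleExtremalBiaxialitySubcriticalOfLiouville
import HarnessLib

/-!
# Route `SqueezeCycle` — item `RecurrentBridge` (stmt-NavierStokesRegularity-15364)

The GLUE of the recurrent decomposition of the crux `ExtremalBiaxialitySubcritical`
(strategist line `recurrent-singular-bridge`):

  `SingularProfileOfNontrivial → RecurrentLiouville → ExtremalBiaxialitySubcritical`.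

Proof (pure logic on top of two tree theorems).

* `squeezeLiouville_of_singularProfile_of_recurrentLiouville` — the two sub-cruxes already give the
  route TARGET `SqueezeLiouville`: if a member `u` of the Type-I KNSS-mild class `𝒦_C` did not
  vanish identically on `t < 0`, `SingularProfileOfNontrivial` (Albritton–Barker 2019 Thm 1.1,
  reverse direction, run inside `𝒦_C`) would produce an origin-singular suitable weak solution on
  the slab `ℝ³ × (−∞, 0)` with weak gradient, `𝐈 < ∞` and the same Type-I rate; the PROVED
  reduction `recurrentReduction_proof` (item stmt-NavierStokesRegularity-1590 of route
  RecurrentProfiles: Birkhoff–Furstenberg minimal sets in the Albritton–Barker class) upgrades it to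
  a uniformly recurrent origin-singular profile of the same class; and `RecurrentLiouville` says such
  a profile is regular at the origin — absurd.
* `recurrentBridge_term_proof` — the item's term: `SqueezeLiouville` implies the crux
  (`extremalBiaxialitySubcritical_of_squeezeLiouville`: the record two-frame inequality for the zero
  slice reads `m ≤ 0 < 1/8`).
* `recurrentBridge_proof : Theses.SqueezeCycle.RecurrentBridge` — the same, typed by the route decl.

## References

* D. Albritton, T. Barker, J. Math. Fluid Mech. 21 (2019), no. 43 = arXiv:1811.00502, Thm 1.1,
  Lemma 2.2, Prop. 2.3. [AlbrittonBarker2019]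
* H. Furstenberg, *Recurrence in Ergodic Theory and Combinatorial Number Theory* (1981), Thm 1.16.
  [Furstenberg1981]
* G. Koch, N. Nadirashvili, G. Seregin, V. Šverák, Acta Math. 203 (2009). [KNSS2009]
-/

noncomputable section

-- the sub-problem namespace repeats the summit name (D-0017 layout `Summit.<S>.<P>.Theorems`)
set_option linter.dupNamespace false

namespace Summit.NavierStokesRegularity.NavierStokesRegularity.Theorems

open Summit.NavierStokesRegularity.NavierStokesRegularity.Theses

/-- **The recurrent line proves the route target.** `SingularProfileOfNontrivial` and
`RecurrentLiouville` (together with the proved reduction `recurrentReduction_proof`, item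
stmt-NavierStokesRegularity-1590) imply `SqueezeLiouville`: every member of `𝒦_C` vanishes on
`t < 0`. Indeed a non-vanishing member has an origin-singular Albritton–Barker slab profile with
`𝐈 < ∞` and the same rate (`SingularProfileOfNontrivial`), which the reduction upgrades to a
uniformly recurrent origin-singular profile of the same class, and `RecurrentLiouville` makes that
profile regular at the origin — contradiction.
[cite: AlbrittonBarker2019, Thm 1.1, Prop. 2.3; Furstenberg1981, Thm 1.16] -/
theorem squeezeLiouville_of_singularProfile_of_recurrentLiouville
    (hS : SqueezeCycle.SingularProfileOfNontrivial) (hR : SqueezeCycle.RecurrentLiouville) :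
    SqueezeCycle.SqueezeLiouville := by
  intro C u hu t ht x
  by_contra hx
  obtain ⟨w, q, H, h1, h2, h3, h4, h5⟩ := hS C u hu ⟨t, ht, x, hx⟩
  obtain ⟨w', q', H', hw1, hw2, hw3, hw4, hw5, hw6⟩ := recurrentReduction_proof w q H C h1 h2 h3 h4 h5
  exact hR w' q' H' C hw1 hw2 hw3 hw4 hw6 hw5

/-- **Item `RecurrentBridge` (stmt-NavierStokesRegularity-15364) as filed**: the glue
`SingularProfileOfNontrivial → RecurrentLiouville → ExtremalBiaxialitySubcritical` of the recurrent
decomposition of the crux `ExtremalBiaxialitySubcritical`. By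
`squeezeLiouville_of_singularProfile_of_recurrentLiouville` every member of `𝒦_C` vanishes on
`t < 0`, so at a record configuration `(C, m, u, t₀, x₀)` the slice `u t₀` is zero, its gradient
vanishes, and the two-frame record inequality reads `m ≤ 0 < 1/8`
(`extremalBiaxialitySubcritical_of_squeezeLiouville`). Term form of the route decl `RecurrentBridge`
(its body verbatim). -/
theorem recurrentBridge_term_proof :
    Summit.NavierStokesRegularity.NavierStokesRegularity.Theses.SqueezeCycle.SingularProfileOfNontrivial →
    Summit.NavierStokesRegularity.NavierStokesRegularity.Theses.SqueezeCycle.RecurrentLiouville →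
    Summit.NavierStokesRegularity.NavierStokesRegularity.Theses.SqueezeCycle.ExtremalBiaxialitySubcritical :=
  fun hS hR =>
    extremalBiaxialitySubcritical_of_squeezeLiouville
      (squeezeLiouville_of_singularProfile_of_recurrentLiouville hS hR)

/-- **Item `RecurrentBridge` (stmt-NavierStokesRegularity-15364)**, stated against the route decl
`Summit.NavierStokesRegularity.NavierStokesRegularity.Theses.SqueezeCycle.RecurrentBridge` itself: the
glue `SingularProfileOfNontrivial → RecurrentLiouville → ExtremalBiaxialitySubcritical` holds
(`recurrentBridge_term_proof`, after unfolding the decl). -/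
theorem recurrentBridge_proof :
    Summit.NavierStokesRegularity.NavierStokesRegularity.Theses.SqueezeCycle.RecurrentBridge := by
  unfold Summit.NavierStokesRegularity.NavierStokesRegularity.Theses.SqueezeCycle.RecurrentBridge
  exact recurrentBridge_term_proof

end Summit.NavierStokesRegularity.NavierStokesRegularity.Theorems

end
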